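import Literature.Algebra.EuclideanLattices.ARVerifierCompleteness
import HarnessLib

/-!
# The Aharonov–Regev integer verifier fed with integer sample vectors: the certificate `certOfVecs` and its acceptance

Topic `Algebra/EuclideanLattices` (family `pqc`). Serves the machine form of Regev 2009,
**Lemma 3.20** (`GapCVP′_{100√n γ} ≤ DGS_{√n γ/λ₁(L*)}`; hypothesis `hL` of
`Literature.Computability.Cryptography.regev_lwe_to_gapSVP_quantum_of_dgs`). There the reduction
"call[s] the DGS oracle `N` times with the lattice `L*` and the value `1/(100d)` … then appl[ies]
`𝒱` with `L`, `t`, `d`, and the vectors `w₁, …, w_N`" (arXiv:2401.03703, p. 22). In the tree the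
oracle is an integer-instance sampler queried on `L((adj(−B))ᵀ) = det(−B) · L(B)*`
(`RegevDualQueryMachine.lean`), so the reduction holds INTEGER vectors `vⱼ = det(−B) · wⱼ ∈ ℤⁿ`, and
`𝒱` is the integer verifier `ARVerifier.Accepts` (`ARVerifier.lean`) on a certificate that the
reduction computes itself. This file fixes that certificate and proves what the assembly needs:

* `certOfVecs B t v` — `C = −adj(−B)`, `D = det(−B)` (the output of the Faddeev–LeVerrier machine,
  `AdjugateMachine.lean`), `aⱼ = (B vⱼ) / D` (integer division; exact on genuine samples),
  `mⱼ = round(eⱼ / D)` for the phase numerator `eⱼ = ⟨t, C aⱼ⟩` — integer arithmetic only;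
* `MAccepts` — the **machine form** of acceptance: `D ≠ 0`, check (a'') and the trace test (c');
  `mAccepts_iff : MAccepts B t d v ↔ Accepts B t d (certOfVecs B t v)` (the matrix identity
  `B C = D · 1` holds by construction, `mul_neg_adjugate_neg`, and check 2 `|2εⱼ| ≤ |D|` holds for
  rounded phases, `abs_two_mul_sub_round_mul_le`);
* `accepts_smulCD_iff` — acceptance is invariant under `(C, D) ↦ (εC, εD)`, `ε = ±1`;
* **`accepts_certOfVecs_iff`** — on GENUINE samples, `castVec (vⱼ) = det(−B) · wⱼ` with
  `wⱼ ∈ L(B)*`, the certificate is `((−1)ⁿ adj B, (−1)ⁿ det B, B wⱼ, round⟨t, wⱼ⟩)`, i.e. the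
  certificate `certOf I t w` of `ARVerifierCompleteness.lean` up to the sign `(−1)ⁿ` of `(C, D)`
  (`certOfVecs_eq_smulCD`), so `Accepts B t d (certOfVecs B t v) ↔ Accepts B t d (certOf I t w)` —
  which transfers the NO-case bound `Pr[Accepts (certOf I t ω)] ≥ 0.829`
  (`ARVerifierRandomWitness.lean`) to the machine, while soundness (`not_accepts_of_infDist_le`,
  YES case) holds for every certificate anyway.

Everything is proved; no named facts.

## References

* O. Regev, *On lattices, learning with errors, random linear codes, and cryptography*, J. ACM 56
  (2009), art. 34; author's version arXiv:2401.03703, Lemma 3.20 (proof, p. 22). [Regev2009]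
* D. Aharonov, O. Regev, *Lattice problems in NP ∩ coNP*, J. ACM 52 (2005) 749–765, §6 (the verifier
  `𝒱`), §6.1–6.2. [AharonovRegev2005]
-/

noncomputable section

namespace Literature.Algebra.EuclideanLattices

namespace ARVerifier

open Matrix
open scoped Real InnerProductSpace

/-! ### Sign flips of `(C, D)` do not change acceptance -/

namespace Cert

variable {n N : ℕ}

/-- The certificate with `(C, D)` multiplied by `ε`. [folklore] -/
def smulCD (ε : ℤ) (c : Cert n N) : Cert n N := ⟨ε • c.C, ε * c.D, c.A, c.m⟩

/-- Field `C` of `smulCD`. [folklore] -/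
@[simp] theorem smulCD_C (ε : ℤ) (c : Cert n N) : (c.smulCD ε).C = ε • c.C := rfl
/-- Field `D` of `smulCD`. [folklore] -/
@[simp] theorem smulCD_D (ε : ℤ) (c : Cert n N) : (c.smulCD ε).D = ε * c.D := rfl
/-- Field `A` of `smulCD`. [folklore] -/
@[simp] theorem smulCD_A (ε : ℤ) (c : Cert n N) : (c.smulCD ε).A = c.A := rfl
/-- Field `m` of `smulCD`. [folklore] -/
@[simp] theorem smulCD_m (ε : ℤ) (c : Cert n N) : (c.smulCD ε).m = c.m := rfl

/-- `dualNum` scales. [folklore] -/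
theorem dualNum_smulCD (ε : ℤ) (c : Cert n N) (j : Fin N) : (c.smulCD ε).dualNum j = ε • c.dualNum j :=
  Matrix.smul_mulVec _ _ _

/-- `phaseNum` scales. [folklore] -/
theorem phaseNum_smulCD (ε : ℤ) (c : Cert n N) (t : Fin n → ℤ) (j : Fin N) :
    (c.smulCD ε).phaseNum t j = ε * c.phaseNum t j := by
  rw [phaseNum, phaseNum, dualNum_smulCD, dotProduct_smul, smul_eq_mul]

/-- `residual` scales. [folklore] -/
theorem residual_smulCD (ε : ℤ) (c : Cert n N) (t : Fin n → ℤ) (j : Fin N) :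
    (c.smulCD ε).residual t j = ε * c.residual t j := by
  rw [residual, residual, phaseNum_smulCD, smulCD_m, smulCD_D]; ring

/-- `sampleMat` scales. [folklore] -/
theorem sampleMat_smulCD (ε : ℤ) (c : Cert n N) : (c.smulCD ε).sampleMat = ε • c.sampleMat := by
  ext i j
  simp [sampleMat, dualNum_smulCD]

end Cert

variable {n : ℕ}

/-- **Acceptance is invariant under `(C, D) ↦ (εC, εD)` for `ε = ±1`.** [folklore] -/
theorem accepts_smulCD_iff {ε : ℤ} (hε : ε = 1 ∨ ε = -1) (B : Matrix (Fin n) (Fin n) ℤ) (t : Fin n → ℤ) (d : ℚ)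
    (c : Cert n (nSamples n)) : Accepts B t d (c.smulCD ε) ↔ Accepts B t d c := by
  have hε2 : ε ^ 2 = 1 := by rcases hε with rfl | rfl <;> norm_num
  have hεε : ε * ε = 1 := by rw [← sq, hε2]
  have hεa : |ε| = 1 := by rcases hε with rfl | rfl <;> norm_num
  have hε0 : ε ≠ 0 := by rcases hε with rfl | rfl <;> norm_num
  have hG : (c.smulCD ε).sampleMat * (c.smulCD ε).sampleMatᵀ = c.sampleMat * c.sampleMatᵀ := by
    rw [Cert.sampleMat_smulCD, transpose_smul, Matrix.smul_mul, Matrix.mul_smul, smul_smul, hεε, one_smul]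
  have hD : ((c.smulCD ε).D ≠ 0) ↔ c.D ≠ 0 := by rw [Cert.smulCD_D]; exact ⟨fun h h0 => h (by rw [h0, mul_zero]), mul_ne_zero hε0⟩
  have hBC : (B * (c.smulCD ε).C = (c.smulCD ε).D • (1 : Matrix (Fin n) (Fin n) ℤ)) ↔
      B * c.C = c.D • (1 : Matrix (Fin n) (Fin n) ℤ) := by
    rw [Cert.smulCD_C, Cert.smulCD_D, Matrix.mul_smul, mul_smul ε c.D (1 : Matrix (Fin n) (Fin n) ℤ)]
    constructor
    · intro h
      have h' := congrArg (fun M : Matrix (Fin n) (Fin n) ℤ => ε • M) h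
      simp only [smul_smul, hεε, one_smul, ← mul_assoc] at h'
      simpa using h'
    · intro h; rw [h, smul_smul]
  have hres : (∀ j, |2 * (c.smulCD ε).residual t j| ≤ |(c.smulCD ε).D|) ↔ ∀ j, |2 * c.residual t j| ≤ |c.D| := by
    refine forall_congr' fun j => ?_
    rw [Cert.residual_smulCD, Cert.smulCD_D, mul_left_comm, abs_mul, abs_mul ε, hεa, one_mul, one_mul]
  have hsum : ((nSamples n : ℤ) * (c.smulCD ε).D ^ 2 ≤ 50 * ∑ j, (c.smulCD ε).residual t j ^ 2) ↔
      (nSamples n : ℤ) * c.D ^ 2 ≤ 50 * ∑ j, c.residual t j ^ 2 := by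
    simp only [Cert.residual_smulCD, Cert.smulCD_D, mul_pow, hε2, one_mul]
  have hD2 : ((d.den : ℤ) * (c.smulCD ε).D) ^ 2 = ((d.den : ℤ) * c.D) ^ 2 := by
    rw [Cert.smulCD_D, mul_pow, mul_pow, mul_pow, hε2, one_mul]
  unfold Accepts
  rw [hD, hBC, hres, hsum, hG, hD2]

/-! ### The certificate computed from integer sample vectors -/

/-- `B · (−adj(−B)) = det(−B) · 1`. [folklore] -/
theorem mul_neg_adjugate_neg (B : Matrix (Fin n) (Fin n) ℤ) :
    B * (-(-B).adjugate) = (-B).det • (1 : Matrix (Fin n) (Fin n) ℤ) := by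
  rw [Matrix.mul_neg, ← Matrix.neg_mul, Matrix.mul_adjugate]

/-- `−adj(−B) = (−1)ⁿ adj B`. [folklore] -/
theorem neg_adjugate_neg (B : Matrix (Fin n) (Fin n) ℤ) : -(-B).adjugate = ((-1 : ℤ) ^ n) • B.adjugate := by
  rcases Nat.eq_zero_or_pos n with hn | hn
  · subst hn
    ext i j; exact i.elim0
  · rw [show -B = (-1 : ℤ) • B from (neg_one_smul ℤ B).symm, adjugate_smul, Fintype.card_fin,
      ← neg_one_smul ℤ (((-1 : ℤ) ^ (n - 1)) • B.adjugate), smul_smul, ← pow_succ', Nat.sub_add_cancel hn]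

/-- `det(−B) = (−1)ⁿ det B`. [folklore] -/
theorem det_neg_fin (B : Matrix (Fin n) (Fin n) ℤ) : (-B).det = (-1 : ℤ) ^ n * B.det := by
  rw [det_neg, Fintype.card_fin]

/-- **The certificate computed from integer sample vectors** `v₁, …, v_N ∈ ℤⁿ` (meant: points of
`det(−B) · L(B)*`): `C = −adj(−B)`, `D = det(−B)`, `aⱼ = (B vⱼ)/D`, `mⱼ = round(⟨t, C aⱼ⟩ / D)`.
[cite: Regev2009, Lemma 3.20 (proof)] [cite: AharonovRegev2005, §6 (p. 10) — variant] -/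
def certOfVecs (B : Matrix (Fin n) (Fin n) ℤ) (t : Fin n → ℤ) {N : ℕ} (v : Fin N → Fin n → ℤ) : Cert n N where
  C := -(-B).adjugate
  D := (-B).det
  A := fun j i => (B *ᵥ v j) i / (-B).det
  m := fun j => round ((((t ⬝ᵥ ((-(-B).adjugate) *ᵥ fun i => (B *ᵥ v j) i / (-B).det)) : ℤ) : ℚ) / ((-B).det : ℚ))

section Fields

variable (B : Matrix (Fin n) (Fin n) ℤ) (t : Fin n → ℤ) {N : ℕ} (v : Fin N → Fin n → ℤ)

/-- Field `C`. [folklore] -/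
@[simp] theorem certOfVecs_C : (certOfVecs B t v).C = -(-B).adjugate := rfl
/-- Field `D`. [folklore] -/
@[simp] theorem certOfVecs_D : (certOfVecs B t v).D = (-B).det := rfl
/-- Field `A`. [folklore] -/
theorem certOfVecs_A (j : Fin N) : (certOfVecs B t v).A j = fun i => (B *ᵥ v j) i / (-B).det := rfl
/-- Field `m` is the rounded phase: `mⱼ = round(eⱼ / D)`. [folklore] -/
theorem certOfVecs_m (j : Fin N) :
    (certOfVecs B t v).m j = round ((((certOfVecs B t v).phaseNum t j : ℤ) : ℚ) / ((certOfVecs B t v).D : ℚ)) := rfl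

end Fields

/-- **Rounded phases pass check 2**: `|2 (e − round(e/D) D)| ≤ |D|` for integers `e`, `D ≠ 0`.
[folklore] -/
theorem abs_two_mul_sub_round_mul_le (e D : ℤ) (hD : D ≠ 0) (r : ℤ) (hr : r = round ((e : ℚ) / (D : ℚ))) :
    |2 * (e - r * D)| ≤ |D| := by
  have hDq : (D : ℚ) ≠ 0 := by exact_mod_cast hD
  have hq : |((e : ℚ) / D) - r| ≤ 1 / 2 := by
    have h := abs_sub_round ((e : ℚ) / (D : ℚ))
    rw [← hr] at h
    exact h
  have e1 : ((e : ℚ) - r * D) = D * (((e : ℚ) / D) - r) := by rw [mul_sub, mul_div_cancel₀ (e : ℚ) hDq]; ring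
  have key : |(2 : ℚ) * ((e : ℚ) - r * D)| ≤ |(D : ℚ)| := by
    rw [e1, abs_mul, abs_mul, abs_two]
    nlinarith [abs_nonneg (D : ℚ)]
  have hcast : ((|2 * (e - r * D)| : ℤ) : ℚ) ≤ ((|D| : ℤ) : ℚ) := by push_cast; exact key
  exact_mod_cast hcast

/-- **The machine form of acceptance**: `D ≠ 0`, test (a'') `N D² ≤ 50 ∑ εⱼ²` and test (c')
`(100p)^{2k} tr((GGᵀ)^k) ≤ (4N(qD)²)^k` for the certificate `certOfVecs B t v`. [cite: AharonovRegev2005, §6 (p. 10) — variant] -/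
def MAccepts (B : Matrix (Fin n) (Fin n) ℤ) (t : Fin n → ℤ) (d : ℚ) (v : Fin (nSamples n) → Fin n → ℤ) : Prop :=
  (-B).det ≠ 0 ∧
    (nSamples n : ℤ) * (-B).det ^ 2 ≤ 50 * ∑ j, (certOfVecs B t v).residual t j ^ 2 ∧
    (100 * d.num) ^ (2 * 2 ^ powSteps n) *
        Matrix.trace (((certOfVecs B t v).sampleMat * (certOfVecs B t v).sampleMatᵀ) ^ 2 ^ powSteps n) ≤
      (4 * (nSamples n : ℤ) * ((d.den : ℤ) * (-B).det) ^ 2) ^ 2 ^ powSteps n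

/-- **`MAccepts ↔ Accepts (certOfVecs …)`**: the matrix identity and check 2 are automatic.
[cite: AharonovRegev2005, §6 (p. 10) — variant] -/
theorem mAccepts_iff (B : Matrix (Fin n) (Fin n) ℤ) (t : Fin n → ℤ) (d : ℚ) (v : Fin (nSamples n) → Fin n → ℤ) :
    MAccepts B t d v ↔ Accepts B t d (certOfVecs B t v) := by
  unfold MAccepts Accepts
  simp only [certOfVecs_D, certOfVecs_C, mul_neg_adjugate_neg, true_and]
  constructor
  · rintro ⟨hD, hsum, htr⟩
    refine ⟨hD, fun j => ?_, hsum, htr⟩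
    rw [Cert.residual, certOfVecs_D]
    exact abs_two_mul_sub_round_mul_le _ _ hD _ (certOfVecs_m B t v j)
  · rintro ⟨hD, -, hsum, htr⟩
    exact ⟨hD, hsum, htr⟩

/-! ### Genuine samples: `certOfVecs` is `certOf` up to the sign `(−1)ⁿ` -/

section Genuine

variable {I : LatticeInstance}

/-- Integer vectors are determined by their real casts. [folklore] -/
theorem castVec_injective : Function.Injective (castVec (n := I.n)) := fun v w h => by
  funext i
  have := congrFun h i
  rw [castVec_apply, castVec_apply] at this
  exact_mod_cast this

/-- `castVec (B *ᵥ v) = (B.map cast) *ᵥ castVec v`. [folklore] -/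
theorem castVec_mulVec (B : Matrix (Fin I.n) (Fin I.n) ℤ) (v : Fin I.n → ℤ) :
    castVec (B *ᵥ v) = (B.map (Int.castRingHom ℝ)) *ᵥ castVec v := by
  ext i
  simp [castVec_apply, mulVec, dotProduct]

/-- **On genuine samples the coordinates `aⱼ = (B vⱼ)/D` are `B wⱼ`**: if `vⱼ = det(−B) · wⱼ` with
`wⱼ ∈ L(B)*` then `B vⱼ = det(−B) · (B wⱼ)` exactly. [cite: Regev2009, Lemma 3.20 (proof)] -/
theorem mulVec_eq_smul_dualCoords {v : Fin I.n → ℤ} {w : dualLattice I.lattice}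
    (hv : castVec v = ((-I.basis).det : ℝ) • coords (w : EuclideanSpace ℝ (Fin I.n))) :
    I.basis *ᵥ v = (-I.basis).det • dualCoords w := by
  apply castVec_injective
  rw [castVec_mulVec, hv, mulVec_smul, basis_mulVec_coords]
  ext i
  simp [castVec_apply]

variable (t : Fin I.n → ℤ) {N : ℕ} {v : Fin N → Fin I.n → ℤ} {ω : Fin N → dualLattice I.lattice}

/-- **`certOfVecs` on genuine samples is `certOf` with `(C, D)` multiplied by `(−1)ⁿ`.**
[cite: Regev2009, Lemma 3.20 (proof)] [cite: AharonovRegev2005, §6.2 — variant] -/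
theorem certOfVecs_eq_smulCD (hI : I.IsNonsingular)
    (hv : ∀ j, castVec (v j) = ((-I.basis).det : ℝ) • coords (ω j : EuclideanSpace ℝ (Fin I.n))) :
    certOfVecs I.basis t v = (certOf I t ω).smulCD ((-1 : ℤ) ^ I.n) := by
  have hD : (-I.basis).det ≠ 0 := by
    rw [det_neg_fin]; exact mul_ne_zero (pow_ne_zero _ (by norm_num)) hI
  have hA : ∀ j, (fun i => (I.basis *ᵥ v j) i / (-I.basis).det) = dualCoords (ω j) := fun j => by
    funext i
    rw [mulVec_eq_smul_dualCoords (hv j), Pi.smul_apply, smul_eq_mul, Int.mul_ediv_cancel_left _ hD]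
  have hC : -(-I.basis).adjugate = ((-1 : ℤ) ^ I.n) • I.basis.adjugate := neg_adjugate_neg I.basis
  -- the phase numerators: `e'ⱼ = (−1)ⁿ eⱼ`, `eⱼ = det B ⟪t, wⱼ⟫`
  have hphase : ∀ j, (t ⬝ᵥ ((-(-I.basis).adjugate) *ᵥ fun i => (I.basis *ᵥ v j) i / (-I.basis).det)) =
      (-1 : ℤ) ^ I.n * (certOf I t ω).phaseNum t j := fun j => by
    rw [hA j, hC, Matrix.smul_mulVec, dotProduct_smul, smul_eq_mul]
    rfl
  have hm : ∀ j, round ((((t ⬝ᵥ ((-(-I.basis).adjugate) *ᵥ fun i => (I.basis *ᵥ v j) i / (-I.basis).det)) : ℤ) : ℚ) /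
      ((-I.basis).det : ℚ)) = round ⟪intVecToEuclidean I.n t, (ω j : EuclideanSpace ℝ (Fin I.n))⟫_ℝ := fun j => by
    rw [hphase j, det_neg_fin]
    have hdet : (I.basis.det : ℝ) ≠ 0 := by exact_mod_cast hI
    have h1 : ((-1 : ℝ) ^ I.n) ≠ 0 := pow_ne_zero _ (by norm_num)
    have hq : (((((-1 : ℤ) ^ I.n * (certOf I t ω).phaseNum t j : ℤ) : ℚ) / (((-1 : ℤ) ^ I.n * I.basis.det : ℤ) : ℚ) : ℚ) : ℝ) =
        ⟪intVecToEuclidean I.n t, (ω j : EuclideanSpace ℝ (Fin I.n))⟫_ℝ := by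
      rw [Rat.cast_div, Rat.cast_intCast, Rat.cast_intCast, Int.cast_mul, Int.cast_mul, Int.cast_pow, Int.cast_neg,
        Int.cast_one, cast_phaseNum_certOf, mul_div_mul_left _ _ h1, mul_div_cancel_left₀ _ hdet]
    rw [← hq, Rat.round_cast]
  rw [certOfVecs]
  simp only [Cert.smulCD, certOf]
  congr 1
  · exact det_neg_fin _
  · funext j; exact hA j
  · funext j; exact hm j

/-- **Acceptance of the machine's certificate on genuine samples is acceptance of `certOf`.**
[cite: Regev2009, Lemma 3.20 (proof, NO case)] -/
theorem accepts_certOfVecs_iff (hI : I.IsNonsingular) (d : ℚ) {v : Fin (nSamples I.n) → Fin I.n → ℤ}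
    {ω : Fin (nSamples I.n) → dualLattice I.lattice}
    (hv : ∀ j, castVec (v j) = ((-I.basis).det : ℝ) • coords (ω j : EuclideanSpace ℝ (Fin I.n))) :
    Accepts I.basis t d (certOfVecs I.basis t v) ↔ Accepts I.basis t d (certOf I t ω) := by
  rw [certOfVecs_eq_smulCD t hI hv]
  exact accepts_smulCD_iff (neg_one_pow_eq_or ℤ I.n) _ _ _ _

/-- The same in machine form. [cite: Regev2009, Lemma 3.20 (proof, NO case)] -/
theorem mAccepts_iff_accepts_certOf (hI : I.IsNonsingular) (d : ℚ) {v : Fin (nSamples I.n) → Fin I.n → ℤ}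
    {ω : Fin (nSamples I.n) → dualLattice I.lattice}
    (hv : ∀ j, castVec (v j) = ((-I.basis).det : ℝ) • coords (ω j : EuclideanSpace ℝ (Fin I.n))) :
    MAccepts I.basis t d v ↔ Accepts I.basis t d (certOf I t ω) := by
  rw [mAccepts_iff, accepts_certOfVecs_iff t hI d hv]

end Genuine

/-- **Soundness for the machine** (YES case): if `dist(t, L(B)) ≤ d`, `d > 0`, the machine form
rejects every tuple of vectors. [cite: AharonovRegev2005, §6.1 (Soundness) — variant] -/
theorem not_mAccepts_of_infDist_le {I : LatticeInstance} {t : Fin I.n → ℤ} {d : ℚ} (hd : 0 < d)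
    (hdist : Metric.infDist (intVecToEuclidean I.n t) (I.lattice : Set (EuclideanSpace ℝ (Fin I.n))) ≤ d)
    (v : Fin (nSamples I.n) → Fin I.n → ℤ) : ¬ MAccepts I.basis t d v := by
  rw [mAccepts_iff]
  exact not_accepts_of_infDist_le hd hdist _

end ARVerifier

end Literature.Algebra.EuclideanLattices

end
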